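import Summits.QuantumFields.BalabanUV.T4Continuum.Support.ShellMeasureAxialReachSUN

/-!
# `T4Continuum.ShellMeasureRegimeWitnessSUN` — the numeric regime of the `SU(N)` level-0 faces is NON-EMPTY for every
# `N`, `d`, `m`: the hypotheses of `ShellMeasureWilsonGaugeInvariantSUN.slotAntiConcentration_wilson_suN_gaugeInvariant`
# (window radius, co-test threshold, the two `N`-dependent reach conditions, (SM) in END-II's currency, (SM)_σ, the
# numbers) are JOINTLY SATISFIABLE together with «shell threshold below the co-test threshold» `θ(1−ρ) < σ`
# (cell `pub-balaban`, sub-cell `t4`, spine estimate NE7c (node U5b); ROUND-2 crew `t4-ne7c-formalise-*`, seat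
# `b2b-balaban-t4-ne7c-formalise-leaf-10` (gen 7); c5 orbit of rows S34∕S43 of `t4/b2b-balaban-t4-ne7c-p1/LEAVES-NE7c-P1.md`;
# the `SU(N)` counterpart of S21 `ShellMeasureSmallnessArithmetic.levelZero_regime_witness` (a numeric instance at
# `SU(2)`, `d = 4`, `m = 1`), here SYMBOLIC in `N`, `d`, `m`; ADDITIVE — imports `ShellMeasureAxialReachSUN` (row S43)
# only (for the record; the statement is pure real arithmetic); 0 `def`, 0 sorry, 0 citations)

HONEST FRAMING.  Finite four-torus programme, rung (B)+1 only — NOT infinite volume, NOT a mass gap, NOT the Clay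
problem, NOT summit progress.  ARITHMETIC ONLY: the witness says the HYPOTHESES of the `SU(N)` level-0 face can hold
simultaneously (so the theorem is not vacuous by contradiction among its numeric binders) and that the shell
threshold can sit below the co-test threshold; it does NOT exhibit a configuration in the shell (measure-level
non-vacuity is the business of the toy files).  (M1)₀ realized ≠ NE7c (c3); `SU(2)` the certified instance (c5);
NOTHING in the countdown moves; NE7c NOT PRINTED, NOT PROVED; spine 0/9.  HONEST DEPENDENCY (cell): continuum YM on
T⁴ ⇐ BetaPertH ∧ nine spine estimates (0/9 proved); BetaPertH ⇐ (D1) ∧ (D4) ∧ CAP+tail; G-an2-4 gates asym, D1 and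
NE2/3/4.

THE WITNESS (`levelZero_regime_exists`).  With `K := √N·(π/2)·(d−1)·m + 1`, `M := N·(d−1)·m`: `δ = 1/2`, `ρ = 1/4`,
`Rad = 2400·K`, `S = 1/(9600·K·(M+1))`, `σ = θ = S/K`.  Then `4S·Rad = 1/(M+1) ≤ 1`, so `e^{4S·Rad} − 1 ≤ 2·4S·Rad`
(Mathlib's `Real.abs_exp_sub_one_sub_id_le`) and (SM) reduces to `1152·S/Rad ≤ S/(2K)`, i.e. `Rad ≥ 2304·K`; (SM)_σ reduces to
`128·K·S·e^{8S} ≤ 1`; the reach conditions hold with room (`M·S/K < 4`, `(K−1)·S/K ≤ S`).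
-/

noncomputable section

namespace Summit.QuantumFields.BalabanUV.T4Continuum.ShellMeasureRegimeWitnessSUN

open Real

/-- **THE NUMERIC REGIME OF THE `SU(N)` LEVEL-0 FACES IS NON-EMPTY, EVERY `N`, `d`, `m`.**  There are `S, σ, θ, δ, ρ, Rad`
satisfying simultaneously: `0 ≤ S ≤ 1/4`, `0 < σ`, the reach conditions `N·((d−1)·m·σ) < 4` and
`√N·(π/2)·((d−1)·m·σ) ≤ S`, `0 < θ`, `0 ≤ δ < 1`, `0 ≤ ρ ≤ (1−δ)/2`, `1 < Rad`, (SM) `36(e^{4S·Rad} − 1)/(Rad − 1)² ≤ δθ`,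
(SM)_σ `4(4S)²e^{8S} ≤ δσ`, AND the shell threshold below the co-test threshold `θ(1−ρ) < σ` — the hypothesis list of
`ShellMeasureWilsonGaugeInvariantSUN.slotAntiConcentration_wilson_suN_gaugeInvariant` (and, dropping the reach and
(SM)∕`Rad`, of `ShellMeasureWilsonRealizedSUN.slotAntiConcentration_wilson_suN`). [folklore] -/
theorem levelZero_regime_exists (N d m : ℕ) :
    ∃ S σ θ δ ρ Rad : ℝ, 0 ≤ S ∧ S ≤ 1 / 4 ∧ 0 < σ ∧
      (N : ℝ) * (((d - 1 : ℕ) : ℝ) * m * σ) < 4 ∧ Real.sqrt N * (Real.pi / 2 * (((d - 1 : ℕ) : ℝ) * m * σ)) ≤ S ∧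
      0 < θ ∧ 0 ≤ δ ∧ δ < 1 ∧ 0 ≤ ρ ∧ ρ ≤ (1 - δ) / 2 ∧ 1 < Rad ∧
      36 * (Real.exp (4 * S * Rad) - 1) / (Rad - 1) ^ 2 ≤ δ * θ ∧
      4 * (4 * S) ^ 2 * Real.exp (2 * (4 * S)) ≤ δ * σ ∧ θ * (1 - ρ) < σ := by
  -- the two box numbers
  set K : ℝ := Real.sqrt N * (Real.pi / 2) * (((d - 1 : ℕ) : ℝ) * m) + 1 with hK
  set M : ℝ := (N : ℝ) * (((d - 1 : ℕ) : ℝ) * m) with hM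
  have hπ0 : 0 < Real.pi := Real.pi_pos
  have hK1 : 1 ≤ K := by
    rw [hK]
    have : 0 ≤ Real.sqrt N * (Real.pi / 2) * (((d - 1 : ℕ) : ℝ) * m) := by positivity
    linarith
  have hK0 : 0 < K := by linarith
  have hM0 : 0 ≤ M := by rw [hM]; positivity
  -- the witness
  set Rad : ℝ := 2400 * K with hRad
  set S : ℝ := 1 / (9600 * K * (M + 1)) with hS
  set σ : ℝ := S / K with hσ
  have hS0 : 0 < S := by rw [hS]; positivity
  have hSle : S ≤ 1 / 9600 := by
    rw [hS]
    apply div_le_div_of_nonneg_left zero_le_one (by norm_num)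
    nlinarith
  have hσ0 : 0 < σ := by rw [hσ]; positivity
  have hσS : σ ≤ S := by
    rw [hσ]
    exact div_le_self hS0.le hK1
  -- `4 S Rad = 1/(M+1)`
  have h4SR : 4 * S * Rad = 1 / (M + 1) := by
    rw [hS, hRad]
    field_simp
    ring
  have h4SR1 : 4 * S * Rad ≤ 1 := by
    rw [h4SR]
    exact (div_le_one (by linarith)).2 (by linarith)
  have h4SR0 : 0 ≤ 4 * S * Rad := by positivity
  refine ⟨S, σ, σ, 1 / 2, 1 / 4, Rad, hS0.le, by linarith, hσ0, ?_, ?_, hσ0, by norm_num, by norm_num, by norm_num,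
    by norm_num, by rw [hRad]; linarith, ?_, ?_, by linarith⟩
  · -- `N·((d−1)·m·σ) = M·S/K < 4`
    have h1 : (N : ℝ) * (((d - 1 : ℕ) : ℝ) * m * σ) = M * (S / K) := by rw [hM, hσ]; ring
    rw [h1]
    have h2 : M * (S / K) ≤ M * S := mul_le_mul_of_nonneg_left (div_le_self hS0.le hK1) hM0
    have h3 : M * S = M / (9600 * K * (M + 1)) := by rw [hS]; ring
    have h4 : M / (9600 * K * (M + 1)) ≤ 1 := by
      rw [div_le_one (by positivity)]
      nlinarith
    linarith
  · -- `√N(π/2)(d−1)m σ = (K − 1)·S/K ≤ S`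
    have h1 : Real.sqrt N * (Real.pi / 2 * (((d - 1 : ℕ) : ℝ) * m * σ)) = (K - 1) * (S / K) := by
      rw [hK, hσ]; ring
    rw [h1]
    have h2 : (K - 1) * (S / K) = S - S / K := by field_simp
    rw [h2]
    have : 0 ≤ S / K := by positivity
    linarith
  · -- (SM): `36(e^{4SRad} − 1)/(Rad−1)² ≤ σ/2`
    -- `e^x − 1 ≤ 2x` on `[0, 1]`, from Mathlib's `|e^x − 1 − x| ≤ x²` (the tree's
    -- `Literature.NumberTheory.Sieve.SquarefreeSums.exp_sub_one_le_two_mul`, not imported here)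
    have hexp : Real.exp (4 * S * Rad) - 1 ≤ 2 * (4 * S * Rad) := by
      have h := Real.abs_exp_sub_one_sub_id_le (x := 4 * S * Rad) (by rwa [abs_of_nonneg h4SR0])
      have h2 : Real.exp (4 * S * Rad) - 1 - 4 * S * Rad ≤ (4 * S * Rad) ^ 2 := (le_abs_self _).trans h
      nlinarith
    have hR2 : 2 ≤ Rad := by rw [hRad]; linarith
    have hden : (Rad / 2) ^ 2 ≤ (Rad - 1) ^ 2 := by nlinarith
    have hden0 : 0 < (Rad / 2) ^ 2 := by positivity
    calc 36 * (Real.exp (4 * S * Rad) - 1) / (Rad - 1) ^ 2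
        ≤ 36 * (2 * (4 * S * Rad)) / (Rad / 2) ^ 2 := by
          apply div_le_div₀ (by positivity) (by linarith) hden0 hden
      _ = 1152 * S / Rad := by
          field_simp
          ring
      _ = 1 / 2 * σ * (2304 * K / Rad) := by rw [hσ]; field_simp; ring
      _ ≤ 1 / 2 * σ * 1 := by
          apply mul_le_mul_of_nonneg_left _ (by positivity)
          rw [div_le_one (by positivity), hRad]
          linarith
      _ = 1 / 2 * σ := mul_one _
  · -- (SM)_σ: `64 S² e^{8S} ≤ σ/2`
    have h8S : 2 * (4 * S) ≤ 1 := by linarith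
    have hexp2 : Real.exp (2 * (4 * S)) ≤ 3 := by
      calc Real.exp (2 * (4 * S)) ≤ Real.exp 1 := Real.exp_le_exp.2 h8S
        _ ≤ 3 := by have := Real.exp_one_lt_d9; linarith
    have hσeq : 1 / 2 * σ = S / (2 * K) := by rw [hσ]; field_simp
    rw [hσeq, le_div_iff₀ (by positivity)]
    -- `4(4S)² e^{8S} · 2K ≤ S` ⟸ `384 K S ≤ 1`
    have hKS : K * S = 1 / (9600 * (M + 1)) := by rw [hS]; field_simp
    have hKS' : K * S ≤ 1 / 9600 := by
      rw [hKS]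
      apply div_le_div_of_nonneg_left zero_le_one (by norm_num)
      nlinarith
    have hgoal : 4 * (4 * S) ^ 2 * Real.exp (2 * (4 * S)) * (2 * K) =
        (128 * (K * S) * Real.exp (2 * (4 * S))) * S := by ring
    rw [hgoal]
    have h1 : 128 * (K * S) * Real.exp (2 * (4 * S)) ≤ 1 :=
      calc 128 * (K * S) * Real.exp (2 * (4 * S)) ≤ 128 * (1 / 9600) * 3 :=
            mul_le_mul (mul_le_mul_of_nonneg_left hKS' (by norm_num)) hexp2 (Real.exp_pos _).le (by positivity)
        _ ≤ 1 := by norm_num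
    calc (128 * (K * S) * Real.exp (2 * (4 * S))) * S ≤ 1 * S := mul_le_mul_of_nonneg_right h1 hS0.le
      _ = S := one_mul S

end Summit.QuantumFields.BalabanUV.T4Continuum.ShellMeasureRegimeWitnessSUN

end
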